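import Summits.AtomisticToContinuum.BoseEinsteinCondensation.Theorems.BECThomsonPrincipleFibreConductanceHealingDefs
import HarnessLib

/-!
# Route `BECThomsonPrinciple`, crux `FibreConductance` (stmt-AtomisticToContinuum-9480),
# line `healing-split-kinetic-defect` — stub `stub_twoScaleSplit`, part I: tiling and fibre tools

Infrastructure for the two-scale block split `stub_twoScaleSplit` (part II,
`BECThomsonPrincipleFibreConductanceStubTwoScaleSplit`) over the vocabulary of
`BECThomsonPrincipleFibreConductanceHealingDefs`:

* generic `ℝ≥0∞` tools: measurable / integrable branch selection by a finite-valued measurable index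
  (`measurable_select`, `integrableOn_select`), square roots `x^{1/2}` and Cauchy–Schwarz in
  square-root form for lower integrals (plain, and with a weight `0 < w < ∞`) and for finite sums;
* the tiling of the fibre `cell L = [0,L)³` by the `(ν+1)³` half-open cubes `cubeSet L ν Q` of side
  `ℓ = L/(ν+1)`: measurability, `cubeIdx = Q` on the cube `Q`, `y ∈ cubeSet (cubeIdx y)` on the cell,
  `cubeSet ⊆ cell`, pairwise disjointness, `cell L = ⋃_Q cubeSet L ν Q`, and the splitting of lower and
  Bochner integrals over the cell into sums over the cubes;
* fibre objects of a test function: the block average `blockAvg` (`Πη(X) = ⨍_{Q(x₀)} η(·, X̂)`;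
  measurable, `= ⨍_Q η` on the cube `Q`, `ε♭·Πη` integrable on `cellN`), `|∇₀η|²` (`gradSq`), the fibre
  integrals `cageFibre` (`a(X̂) = ∫_cell σ_{Q(y)} |ε♭|²/ψ² dy`) and `energyFibre`
  (`b(X̂) = ∫_cell |∇₀η|² ψ² dy`), their measurability, and the three bath identities
  `∫_{cellN} a·W = L³·cageIntegral`, `∫_{cellN} b/W = L³·dualEnergy`, `∫_{cellN} κ·W = L³·coarseIntegral`
  (fibre Fubini `lintegral_cellN_lintegral_update`; `W`, `σ`, `κ` are fibre-constant).

Registered anchor (`--supports` the crux item): `lintegral_kappa_mul`.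
All [folklore] (elementary measure theory on the torus).
-/

noncomputable section

namespace Summit.AtomisticToContinuum.BoseEinsteinCondensation.Cruxes.FibreConductance.HealingSplitKineticDefect

open MeasureTheory Set
open scoped ENNReal
open Literature.MathematicalPhysics.QuantumManyBody.BoseGas
open Summit.AtomisticToContinuum.BoseEinsteinCondensation.Cruxes.FibreConductance.ParsevalShellBootstrap

variable {m : ℕ} {L : ℝ}

/-! ### Notation for the fibre objects of a test function (no new definitions) -/

/-- `Πη(X) = ⨍_{Q(x₀)} η(·, X̂)`: the BLOCK AVERAGE, read at the cube of `x₀`. -/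
local notation "bAvg[" L ", " ν ", " η ", " X "]" => cubeAvg L ν η (cubeIdx L ν (X 0)) X

/-- `|∇₀η|²(X) = Σ_l ‖∂_{0,l}η(X)‖²`. -/
local notation "gSq[" η ", " X "]" => ∑ l : Fin 3, ‖fderiv ℝ η X (e0 _ l)‖ ^ 2

/-- `a(X̂) = ∫_cell σ_{Q(y)}(X̂) |ε♭(y, X̂)|²/ψ(y|X̂)² dy` (cage fibre integral). -/
local notation "cageF[" L ", " ν ", " σ ", " n ", " Φ ", " X "]" =>
  ∫⁻ y in cell L, σ (cubeIdx L ν y) X * ENNReal.ofReal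
    (‖gradDefect n Φ (Function.update X 0 y)‖ ^ 2 / fibrePsi Φ (Function.update X 0 y) ^ 2)

/-- `b(X̂) = ∫_cell |∇₀η(y, X̂)|² ψ(y|X̂)² dy` (energy fibre integral). -/
local notation "enF[" L ", " Φ ", " η ", " X "]" =>
  ∫⁻ y in cell L, ENNReal.ofReal ((∑ l : Fin 3, ‖fderiv ℝ η (Function.update X 0 y) (e0 _ l)‖ ^ 2) *
    fibrePsi Φ (Function.update X 0 y) ^ 2)

/-! ### Generic tools: branch selection, square roots and Cauchy–Schwarz in `ℝ≥0∞` -/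

section Tools

variable {α : Type*} [MeasurableSpace α] {ι : Type*} [MeasurableSpace ι] [MeasurableSingletonClass ι]

/-- Selecting a measurable branch by a measurable countably-valued index is measurable. [folklore] -/
theorem measurable_select [Countable ι] {β : Type*} [MeasurableSpace β] {g : α → ι} (hg : Measurable g)
    {F : ι → α → β} (hF : ∀ i, Measurable (F i)) : Measurable fun x => F (g x) x :=
  (measurable_from_prod_countable_left (f := fun p : α × ι => F p.2 p.1) fun i => hF i).comp
    (measurable_id.prodMk hg)

/-- Selecting an integrable branch by a measurable index with finitely many values is
integrable. [folklore] -/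
theorem integrableOn_select [Fintype ι] {E : Type*} [NormedAddCommGroup E] {μ : Measure α}
    {s : Set α} {g : α → ι} (hg : Measurable g) {F : ι → α → E}
    (hF : ∀ i, IntegrableOn (F i) s μ) : IntegrableOn (fun x => F (g x) x) s μ := by
  have h : (fun x => F (g x) x) = fun x => ∑ i, (g ⁻¹' {i}).indicator (F i) x := by
    funext x
    rw [Finset.sum_eq_single (g x) (fun i _ hi => indicator_of_notMem (by simpa using hi.symm) _)
      (by simp), indicator_of_mem (by simp)]
  rw [h]
  exact integrable_finsetSum _ fun i _ => (hF i).indicator (hg (measurableSet_singleton i))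

/-- If `x ≤ c^{1/2} u^{1/2} v^{1/2}` then `x² ≤ c·u·v`. [folklore] -/
theorem sq_le_of_le_sqrt {x c u v : ℝ≥0∞}
    (h : x ≤ c ^ (1 / 2 : ℝ) * u ^ (1 / 2 : ℝ) * v ^ (1 / 2 : ℝ)) : x ^ 2 ≤ c * u * v := by
  have e : ∀ y : ℝ≥0∞, (y ^ (1 / 2 : ℝ)) ^ 2 = y := fun y => by
    rw [← ENNReal.rpow_natCast, ← ENNReal.rpow_mul]; norm_num
  calc x ^ 2 ≤ (c ^ (1 / 2 : ℝ) * u ^ (1 / 2 : ℝ) * v ^ (1 / 2 : ℝ)) ^ 2 := by gcongr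
    _ = c * u * v := by rw [mul_pow, mul_pow, e, e, e]

/-- A factorisation of `ofReal (u v)` into two square roots through a positive weight `ψ`. [folklore] -/
theorem ofReal_mul_eq_sqrt_mul_sqrt {u v ψ : ℝ} (hu : 0 ≤ u) (hv : 0 ≤ v) (hψ : 0 < ψ) :
    ENNReal.ofReal (u * v) =
      ENNReal.ofReal (u ^ 2 / ψ ^ 2) ^ (1 / 2 : ℝ) * ENNReal.ofReal (v ^ 2 * ψ ^ 2) ^ (1 / 2 : ℝ) := by
  rw [← ENNReal.mul_rpow_of_nonneg _ _ (by norm_num), ← ENNReal.ofReal_mul (by positivity),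
    show u ^ 2 / ψ ^ 2 * (v ^ 2 * ψ ^ 2) = (u * v) ^ 2 by field_simp,
    ENNReal.ofReal_pow (by positivity), ← ENNReal.rpow_natCast, ← ENNReal.rpow_mul]
  norm_num

/-- Cauchy–Schwarz in `ℝ≥0∞`, square-root form. [folklore] -/
theorem lintegral_sqrt_mul_sqrt_le (μ : Measure α) {f g : α → ℝ≥0∞} (hf : AEMeasurable f μ)
    (hg : AEMeasurable g μ) :
    ∫⁻ x, f x ^ (1 / 2 : ℝ) * g x ^ (1 / 2 : ℝ) ∂μ ≤
      (∫⁻ x, f x ∂μ) ^ (1 / 2 : ℝ) * (∫⁻ x, g x ∂μ) ^ (1 / 2 : ℝ) := by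
  have e : ∀ y : ℝ≥0∞, (y ^ (1 / 2 : ℝ)) ^ (2 : ℝ) = y := fun y => by
    rw [← ENNReal.rpow_mul]; norm_num
  have h := ENNReal.lintegral_mul_le_Lp_mul_Lq μ Real.HolderConjugate.two_two
    (hf.pow_const (1 / 2 : ℝ)) (hg.pow_const (1 / 2 : ℝ))
  simpa only [Pi.mul_apply, e] using h

/-- Weighted Cauchy–Schwarz: `∫ f^{1/2} g^{1/2} ≤ (∫ f w)^{1/2} (∫ g/w)^{1/2}` (`0 < w < ∞`). [folklore] -/
theorem lintegral_sqrt_mul_sqrt_le_weighted (μ : Measure α) {f g w : α → ℝ≥0∞}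
    (hf : AEMeasurable f μ) (hg : AEMeasurable g μ) (hw : AEMeasurable w μ) (h0 : ∀ x, w x ≠ 0)
    (htop : ∀ x, w x ≠ ⊤) :
    ∫⁻ x, f x ^ (1 / 2 : ℝ) * g x ^ (1 / 2 : ℝ) ∂μ ≤
      (∫⁻ x, f x * w x ∂μ) ^ (1 / 2 : ℝ) * (∫⁻ x, g x * (w x)⁻¹ ∂μ) ^ (1 / 2 : ℝ) := by
  have hpt : ∀ x, f x ^ (1 / 2 : ℝ) * g x ^ (1 / 2 : ℝ) =
      (f x * w x) ^ (1 / 2 : ℝ) * (g x * (w x)⁻¹) ^ (1 / 2 : ℝ) := by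
    intro x
    rw [← ENNReal.mul_rpow_of_nonneg _ _ (by norm_num), ← ENNReal.mul_rpow_of_nonneg _ _ (by norm_num),
      mul_mul_mul_comm, ENNReal.mul_inv_cancel (h0 x) (htop x), mul_one]
  simp_rw [hpt]
  exact lintegral_sqrt_mul_sqrt_le μ (hf.mul hw) (hg.mul hw.inv)

/-- Cauchy–Schwarz for finite sums in `ℝ≥0∞`, square-root form. [folklore] -/
theorem sum_sqrt_mul_sqrt_le {κ : Type*} (s : Finset κ) (f g : κ → ℝ≥0∞) :
    ∑ i ∈ s, f i ^ (1 / 2 : ℝ) * g i ^ (1 / 2 : ℝ) ≤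
      (∑ i ∈ s, f i) ^ (1 / 2 : ℝ) * (∑ i ∈ s, g i) ^ (1 / 2 : ℝ) := by
  have e : ∀ y : ℝ≥0∞, (y ^ (1 / 2 : ℝ)) ^ (2 : ℝ) = y := fun y => by
    rw [← ENNReal.rpow_mul]; norm_num
  have h := ENNReal.inner_le_Lp_mul_Lq s (fun i => f i ^ (1 / 2 : ℝ)) (fun i => g i ^ (1 / 2 : ℝ))
    Real.HolderConjugate.two_two
  simpa only [e] using h

/-- `ofReal ‖∫ f‖ ≤ ∫⁻ ofReal ‖f‖`. [folklore] -/
theorem ofReal_norm_integral_le {E : Type*} [NormedAddCommGroup E] [NormedSpace ℝ E]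
    (μ : Measure α) (f : α → E) :
    ENNReal.ofReal ‖∫ x, f x ∂μ‖ ≤ ∫⁻ x, ENNReal.ofReal ‖f x‖ ∂μ :=
  (ENNReal.ofReal_le_ofReal (norm_integral_le_lintegral_norm f)).trans ENNReal.ofReal_toReal_le

end Tools

/-! ### The tiling of the fibre `[0,L)³` into `(ν+1)³` cubes -/

/-- `ℓ > 0`. [folklore] -/
theorem side_pos (hL : 0 < L) (ν : ℕ) : 0 < side L ν := div_pos hL (by positivity)

/-- `(ν+1)ℓ = L`. [folklore] -/
theorem succ_mul_side (L : ℝ) (ν : ℕ) : ((ν : ℝ) + 1) * side L ν = L := by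
  unfold side; field_simp

/-- On the cube `Q` the cube index is `Q`. [folklore] -/
theorem cubeIdx_of_mem_cubeSet (hL : 0 < L) {ν : ℕ} {Q : Fin 3 → Fin (ν + 1)} {y : Space}
    (hy : y ∈ cubeSet L ν Q) : cubeIdx L ν y = Q := by
  have hs := side_pos hL ν
  funext l
  obtain ⟨h1, h2⟩ := hy l
  have hfl : ⌊y l / side L ν⌋₊ = (Q l : ℕ) := by
    rw [Nat.floor_eq_iff (div_nonneg (le_trans (by positivity) h1) hs.le), le_div_iff₀ hs,
      div_lt_iff₀ hs]
    exact ⟨h1, h2⟩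
  simp only [cubeIdx, hfl]
  exact Fin.ext (min_eq_right (Nat.lt_succ_iff.mp (Q l).isLt))

/-- Every point of the cell lies in the cube of its index. [folklore] -/
theorem mem_cubeSet_cubeIdx (hL : 0 < L) (ν : ℕ) {y : Space} (hy : y ∈ cell L) :
    y ∈ cubeSet L ν (cubeIdx L ν y) := by
  have hs := side_pos hL ν
  intro l
  obtain ⟨h0, hyL⟩ := hy l
  have hq : 0 ≤ y l / side L ν := div_nonneg h0 hs.le
  have hlt : ⌊y l / side L ν⌋₊ < ν + 1 := by
    refine (Nat.floor_lt hq).2 ?_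
    rw [div_lt_iff₀ hs]
    push_cast
    rwa [succ_mul_side]
  have hmin : min ν ⌊y l / side L ν⌋₊ = ⌊y l / side L ν⌋₊ := min_eq_right (Nat.lt_succ_iff.mp hlt)
  simp only [cubeIdx, hmin, mem_Ico]
  exact ⟨by rw [← le_div_iff₀ hs]; exact Nat.floor_le hq,
    by rw [← div_lt_iff₀ hs]; exact Nat.lt_floor_add_one _⟩

/-- The cubes lie in the cell. [folklore] -/
theorem cubeSet_subset_cell (hL : 0 < L) {ν : ℕ} (Q : Fin 3 → Fin (ν + 1)) :
    cubeSet L ν Q ⊆ cell L := by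
  have hs := side_pos hL ν
  intro y hy l
  obtain ⟨h1, h2⟩ := hy l
  refine ⟨le_trans (by positivity) h1, h2.trans_le ?_⟩
  calc (((Q l : ℕ) : ℝ) + 1) * side L ν ≤ ((ν : ℝ) + 1) * side L ν := by
        gcongr
        exact_mod_cast Nat.lt_succ_iff.mp (Q l).isLt
    _ = L := succ_mul_side L ν

/-- The cubes are measurable. [folklore] -/
theorem measurableSet_cubeSet (L : ℝ) (ν : ℕ) (Q : Fin 3 → Fin (ν + 1)) :
    MeasurableSet (cubeSet L ν Q) := by
  have h : cubeSet L ν Q = ⋂ l, (fun y : Space => y l) ⁻¹'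
      Ico (((Q l : ℕ) : ℝ) * side L ν) ((((Q l : ℕ) : ℝ) + 1) * side L ν) := by
    ext y; simp [cubeSet]
  rw [h]
  exact MeasurableSet.iInter fun l => measurableSet_Ico.preimage (by fun_prop)

/-- The cube index is a measurable function of the point. [folklore] -/
theorem measurable_cubeIdx (L : ℝ) (ν : ℕ) : Measurable (cubeIdx L ν) := by
  refine measurable_pi_lambda _ fun l => ?_
  exact (measurable_from_nat (f := fun k : ℕ =>
      (⟨min ν k, Nat.lt_succ_of_le (min_le_left _ _)⟩ : Fin (ν + 1)))).comp
    (Nat.measurable_floor.comp (by fun_prop : Measurable fun y : Space => y l / side L ν))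

/-- The cubes are pairwise disjoint. [folklore] -/
theorem pairwise_disjoint_cubeSet (hL : 0 < L) (ν : ℕ) :
    Pairwise (Function.onFun Disjoint (cubeSet L ν)) := fun _ _ hQQ' =>
  disjoint_left.2 fun _ hy hy' =>
    hQQ' ((cubeIdx_of_mem_cubeSet hL hy).symm.trans (cubeIdx_of_mem_cubeSet hL hy'))

/-- The cubes tile the cell. [folklore] -/
theorem cell_eq_iUnion_cubeSet (hL : 0 < L) (ν : ℕ) : cell L = ⋃ Q, cubeSet L ν Q :=
  Subset.antisymm (fun _ hy => mem_iUnion.2 ⟨_, mem_cubeSet_cubeIdx hL ν hy⟩)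
    (iUnion_subset fun Q => cubeSet_subset_cell hL Q)

/-- Lower Lebesgue integrals over the cell split over the cubes. [folklore] -/
theorem lintegral_cell_eq_sum (hL : 0 < L) (ν : ℕ) (f : Space → ℝ≥0∞) :
    ∫⁻ y in cell L, f y = ∑ Q : Fin 3 → Fin (ν + 1), ∫⁻ y in cubeSet L ν Q, f y := by
  rw [cell_eq_iUnion_cubeSet hL ν, lintegral_iUnion (measurableSet_cubeSet L ν)
    (pairwise_disjoint_cubeSet hL ν), tsum_fintype]

/-- Bochner integrals over the cell split over the cubes. [folklore] -/
theorem integral_cell_eq_sum (hL : 0 < L) (ν : ℕ) {f : Space → ℂ}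
    (hf : ∀ Q, IntegrableOn f (cubeSet L ν Q)) :
    ∫ y in cell L, f y = ∑ Q : Fin 3 → Fin (ν + 1), ∫ y in cubeSet L ν Q, f y := by
  rw [cell_eq_iUnion_cubeSet hL ν]
  exact integral_iUnion_fintype (measurableSet_cubeSet L ν) (pairwise_disjoint_cubeSet hL ν) hf

/-- A continuous function on the fibre is integrable on every cube. [folklore] -/
theorem integrableOn_cubeSet (hL : 0 < L) {ν : ℕ} (Q : Fin 3 → Fin (ν + 1)) {E : Type*}
    [NormedAddCommGroup E] {f : Space → E} (hf : Continuous f) : IntegrableOn f (cubeSet L ν Q) :=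
  (integrableOn_cell hf).mono_set (cubeSet_subset_cell hL Q)

/-! ### Fibre objects of a test function: block average, local energies, bath identities -/

/-- Cube averages are constant along the fibre. [folklore] -/
theorem cubeAvg_update (L : ℝ) (ν : ℕ) (η : Config (m + 1) → ℂ) (Q : Fin 3 → Fin (ν + 1))
    (X : Config (m + 1)) (y : Space) :
    cubeAvg L ν η Q (Function.update X 0 y) = cubeAvg L ν η Q X := by
  simp only [cubeAvg, Function.update_idem]

/-- Cube averages of a continuous function depend continuously on the configuration. [folklore] -/
theorem continuous_cubeAvg (hL : 0 < L) (ν : ℕ) {η : Config (m + 1) → ℂ} (hη : Continuous η)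
    (Q : Fin 3 → Fin (ν + 1)) : Continuous (cubeAvg L ν η Q) := by
  unfold cubeAvg
  exact (continuous_parametric_setIntegral_of_isBounded (μ := volume)
    ((isBounded_cell L).subset (cubeSet_subset_cell hL Q)) (measurableSet_cubeSet L ν Q)
    (hη.comp continuous_update_zero)).const_smul ((side L ν)⁻¹ ^ 3 : ℝ)

/-- On the cube `Q` of a fibre the block average is `⨍_Q η`. [folklore] -/
theorem blockAvg_update (hL : 0 < L) {ν : ℕ} {η : Config (m + 1) → ℂ} {Q : Fin 3 → Fin (ν + 1)}
    (X : Config (m + 1)) {y : Space} (hy : y ∈ cubeSet L ν Q) :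
    bAvg[L, ν, η, Function.update X 0 y] = cubeAvg L ν η Q X := by
  rw [Function.update_self, cubeIdx_of_mem_cubeSet hL hy, cubeAvg_update]

/-- The block average is measurable. [folklore] -/
theorem measurable_blockAvg (hL : 0 < L) (ν : ℕ) {η : Config (m + 1) → ℂ} (hη : Continuous η) :
    Measurable fun X => bAvg[L, ν, η, X] :=
  measurable_select ((measurable_cubeIdx L ν).comp (measurable_pi_apply 0)) fun Q =>
    (continuous_cubeAvg hL ν hη Q).measurable

/-- `ε♭ · Πη` is integrable on the cell. [folklore] -/
theorem integrableOn_gradDefect_mul_blockAvg (hL : 0 < L) (ν : ℕ) (n : Fin 3 → ℤ)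
    (Φ : PeriodicTrialState (m + 1) L) (hΦ : ∀ X, Φ.ψ X ≠ 0) {η : Config (m + 1) → ℂ}
    (hη : Continuous η) :
    IntegrableOn (fun X => gradDefect n Φ X * bAvg[L, ν, η, X]) (cellN (m + 1) L) :=
  integrableOn_select (F := fun Q X => gradDefect n Φ X * cubeAvg L ν η Q X)
    ((measurable_cubeIdx L ν).comp (measurable_pi_apply 0)) fun Q =>
    integrableOn_cellN ((continuous_gradDefect hL n Φ hΦ).mul (continuous_cubeAvg hL ν hη Q)) L

/-- `|∇₀η|²` is continuous for a `C¹` test function. [folklore] -/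
theorem continuous_gradSq {η : Config (m + 1) → ℂ} (hη : ContDiff ℝ 1 η) : Continuous fun X => gSq[η, X] :=
  continuous_finsetSum _ fun _ _ =>
    (((hη.continuous_fderiv one_ne_zero).clm_apply continuous_const).norm).pow 2

/-- `ofReal` of a local energy over a measurable part of the fibre is the lower integral of its
density. [folklore] -/
theorem ofReal_locEnergy (hL : 0 < L) (Φ : PeriodicTrialState (m + 1) L) (hΦ : ∀ X, Φ.ψ X ≠ 0)
    {η : Config (m + 1) → ℂ} (hη : ContDiff ℝ 1 η) {S : Set Space} (hS : S ⊆ cell L)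
    (X : Config (m + 1)) :
    ENNReal.ofReal (locEnergy Φ S η X) = ∫⁻ y in S, ENNReal.ofReal
      (gSq[η, Function.update X 0 y] * fibrePsi Φ (Function.update X 0 y) ^ 2) := by
  have hu : Continuous fun y : Space => Function.update X 0 y := continuous_const.update 0 continuous_id
  have hc : Continuous fun y : Space =>
      gSq[η, Function.update X 0 y] * fibrePsi Φ (Function.update X 0 y) ^ 2 :=
    ((continuous_gradSq hη).comp hu).mul (((continuous_fibrePsi hL Φ hΦ).comp hu).pow 2)
  exact ofReal_integral_eq_lintegral_ofReal ((integrableOn_cell hc).mono_set hS)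
    (Filter.Eventually.of_forall fun y => by positivity)

/-- The cage fibre integral `a` is measurable. [folklore] -/
theorem measurable_cageFibre (hL : 0 < L) {ν : ℕ} (n : Fin 3 → ℤ) (Φ : PeriodicTrialState (m + 1) L)
    (hΦ : ∀ X, Φ.ψ X ≠ 0) {σ : (Fin 3 → Fin (ν + 1)) → Config (m + 1) → ℝ≥0∞}
    (hσ : IsPoincareField L ν Φ σ) : Measurable fun X => cageF[L, ν, σ, n, Φ, X] := by
  have h1 : Measurable fun p : Config (m + 1) × Space => σ (cubeIdx L ν p.2) p.1 :=
    measurable_select ((measurable_cubeIdx L ν).comp measurable_snd) fun Q =>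
      (hσ.1 Q).comp measurable_fst
  have hε := continuous_gradDefect hL n Φ hΦ
  have hψ := continuous_fibrePsi hL Φ hΦ
  have hu : Continuous fun p : Config (m + 1) × Space => Function.update p.1 0 p.2 :=
    continuous_fst.update 0 continuous_snd
  have h2 : Measurable fun p : Config (m + 1) × Space => ENNReal.ofReal
      (‖gradDefect n Φ (Function.update p.1 0 p.2)‖ ^ 2 /
        fibrePsi Φ (Function.update p.1 0 p.2) ^ 2) :=
    (((hε.comp hu).norm.pow 2).measurable.div ((hψ.comp hu).pow 2).measurable).ennreal_ofReal
  exact (h1.mul h2).lintegral_prod_right' (ν := volume.restrict (cell L))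

/-- The energy fibre integral `b` is measurable. [folklore] -/
theorem measurable_energyFibre (hL : 0 < L) (Φ : PeriodicTrialState (m + 1) L)
    (hΦ : ∀ X, Φ.ψ X ≠ 0) {η : Config (m + 1) → ℂ} (hη : ContDiff ℝ 1 η) :
    Measurable fun X => enF[L, Φ, η, X] := by
  have hu : Continuous fun p : Config (m + 1) × Space => Function.update p.1 0 p.2 :=
    continuous_fst.update 0 continuous_snd
  have h : Measurable fun p : Config (m + 1) × Space => ENNReal.ofReal
      (gSq[η, Function.update p.1 0 p.2] * fibrePsi Φ (Function.update p.1 0 p.2) ^ 2) :=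
    (((continuous_gradSq hη).comp hu).mul
      (((continuous_fibrePsi hL Φ hΦ).comp hu).pow 2)).measurable.ennreal_ofReal
  exact h.lintegral_prod_right' (ν := volume.restrict (cell L))

/-- `∫_{cellN} a·W = L³ · cageIntegral` (the weights are fibre-constant). [folklore] -/
theorem lintegral_cageFibre_mul (hL : 0 < L) {ν : ℕ} (n : Fin 3 → ℤ)
    (Φ : PeriodicTrialState (m + 1) L) (hΦ : ∀ X, Φ.ψ X ≠ 0)
    {σ : (Fin 3 → Fin (ν + 1)) → Config (m + 1) → ℝ≥0∞} (hσ : IsPoincareField L ν Φ σ) :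
    ∫⁻ X in cellN (m + 1) L, cageF[L, ν, σ, n, Φ, X] * ENNReal.ofReal (fibreW Φ X) =
      ENNReal.ofReal L ^ 3 * cageIntegral L ν σ n Φ := by
  have hε := continuous_gradDefect hL n Φ hΦ
  have hψ := continuous_fibrePsi hL Φ hΦ
  have hW := continuous_fibreW Φ
  have hH : Measurable fun X => σ (cubeIdx L ν (X 0)) X *
      ENNReal.ofReal (fibreW Φ X * ‖gradDefect n Φ X‖ ^ 2 / fibrePsi Φ X ^ 2) :=
    (measurable_select ((measurable_cubeIdx L ν).comp (measurable_pi_apply 0)) hσ.1).mul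
      (((hW.mul (hε.norm.pow 2)).measurable.div (hψ.pow 2).measurable).ennreal_ofReal)
  rw [cageIntegral, ← lintegral_cellN_lintegral_update 0 hH]
  refine setLIntegral_congr_fun (measurableSet_cellN _ L) fun X _ => ?_
  rw [← lintegral_mul_const' _ _ ENNReal.ofReal_ne_top]
  refine setLIntegral_congr_fun (measurableSet_cell L) fun y _ => ?_
  simp only [Function.update_self, hσ.2.1, fibreW_update]
  rw [mul_div_assoc, ENNReal.ofReal_mul (fibreW_nonneg Φ X)]
  ring

/-- `∫_{cellN} b/W = L³ · dualEnergy`. [folklore] -/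
theorem lintegral_energyFibre_mul (hL : 0 < L) (Φ : PeriodicTrialState (m + 1) L)
    (hΦ : ∀ X, Φ.ψ X ≠ 0) {η : Config (m + 1) → ℂ} (hη : ContDiff ℝ 1 η) :
    ∫⁻ X in cellN (m + 1) L, enF[L, Φ, η, X] * (ENNReal.ofReal (fibreW Φ X))⁻¹ =
      ENNReal.ofReal L ^ 3 * dualEnergy Φ η := by
  have hH : Measurable fun X => ENNReal.ofReal (gSq[η, X] * (fibrePsi Φ X ^ 2 / fibreW Φ X)) :=
    ((continuous_gradSq hη).measurable.mul
      (((continuous_fibrePsi hL Φ hΦ).pow 2).measurable.div (measurable_fibreW Φ))).ennreal_ofReal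
  rw [dualEnergy, ← lintegral_cellN_lintegral_update 0 hH]
  refine setLIntegral_congr_fun (measurableSet_cellN _ L) fun X _ => ?_
  have hW := fibreW_pos hL Φ hΦ X
  rw [← lintegral_mul_const' _ _ (ENNReal.inv_ne_top.2 (ENNReal.ofReal_pos.2 hW).ne')]
  refine setLIntegral_congr_fun (measurableSet_cell L) fun y _ => ?_
  rw [fibreW_update, ← div_eq_mul_inv, ← ENNReal.ofReal_div_of_pos hW, mul_div_assoc]

/-- `∫_{cellN} κ·W = L³ · coarseIntegral` (`|Φ|² = Wψ²` integrates to `W` on every fibre). [folklore] -/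
theorem lintegral_kappa_mul (Φ : PeriodicTrialState (m + 1) L) {κ : Config (m + 1) → ℝ≥0∞}
    (hκ : Measurable κ) (hfc : ∀ (X : Config (m + 1)) (y : Space), κ (Function.update X 0 y) = κ X) :
    ∫⁻ X in cellN (m + 1) L, κ X * ENNReal.ofReal (fibreW Φ X) =
      ENNReal.ofReal L ^ 3 * coarseIntegral Φ κ := by
  have hH : Measurable fun X => ENNReal.ofReal (‖Φ.ψ X‖ ^ 2) * κ X :=
    (Φ.contDiff.continuous.norm.pow 2).measurable.ennreal_ofReal.mul hκ
  rw [coarseIntegral, ← lintegral_cellN_lintegral_update 0 hH]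
  refine setLIntegral_congr_fun (measurableSet_cellN _ L) fun X _ => ?_
  have hc : Continuous fun y : Space => ‖Φ.ψ (Function.update X 0 y)‖ ^ 2 :=
    ((continuous_slice Φ X).norm).pow 2
  rw [fibreW, ofReal_integral_eq_lintegral_ofReal (integrableOn_cell hc)
    (Filter.Eventually.of_forall fun y => sq_nonneg _), mul_comm,
    ← lintegral_mul_const _ hc.measurable.ennreal_ofReal]
  refine setLIntegral_congr_fun (measurableSet_cell L) fun y _ => ?_
  rw [hfc]

end Summit.AtomisticToContinuum.BoseEinsteinCondensation.Cruxes.FibreConductance.HealingSplitKineticDefect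

end
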